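import Literature.NumberTheory.EllipticCurves.DeligneSerreRankinProp51Proofs
import Literature.NumberTheory.EllipticCurves.DeligneSerreProp27Proofs
import Literature.NumberTheory.EllipticCurves.DeligneSerreProp27WeightReductionProofs
import Literature.NumberTheory.EllipticCurves.DeligneSerreProp27RealLatticeProofs
import Literature.NumberTheory.EllipticCurves.EichlerShimuraPeriodsGamma1RealSpanProofs
import HarnessLib

/-!
# Deligne–Serre 1974, Prop. 5.5: reduction to the spanning statement (2.7.2)

The named fact `Literature.NumberTheory.EllipticCurves.ModularForms.DeligneSerre1974.prop55`
(`Literature.NumberTheory.EllipticCurves.DeligneSerreRankin`; Deligne–Serre, *Formes modulaires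
de poids 1*, Prop. 5.5: for a non-zero cusp form `f` of type `(1, ε)` on `Γ₀(N)` which is an
eigenfunction of the `T_p`, `p ∤ N`, and every `η > 0`, there are a set of primes `X_η` with
`dens.sup X_η ≤ η` and a finite `Y_η ⊂ ℂ` with `a_p ∈ Y_η` for `p ∉ X_η`) is proved in print
(op. cit. p. 520) from Prop. 5.1 (Rankin's estimate) and Prop. 2.7 ((2.7.3): the `a_p` are
integers of a number field `K`; (2.7.4): the conjugates `σ(a_p)` are again eigenvalues of weight-one
eigenforms).  In the tree

* the p. 520 argument is `prop55_of` (`DeligneSerreRankinProofs`),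
* Prop. 5.1 is proved, `prop51_holds` (`DeligneSerreRankinProp51Proofs`),
* (2.7.3) and (2.7.4) are proved from the spanning statement (2.7.2)
  `DeligneSerre1974_span_integralLattice1 N k` ("`S_ℂ = ℂ ⊗ L`", `L` the lattice of cusp forms all
  of whose diamond twists have integral `q`-expansion) for all levels and weights
  (`prop27_eigenvalues_of_span_integralLattice1`, `prop27_conj_of_span_integralLattice1`,
  `DeligneSerreProp27Proofs`),
* and (2.7.2) in every weight follows, level by level, from (2.7.2) in all weights `k ≥ K₀` for any
  threshold `K₀` (`DeligneSerre1974_span_integralLattice1.of_forall_le`, op. cit. Rem. 2.8 with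
  `E₄, E₆` in place of `Δ`; `DeligneSerreProp27WeightReductionProofs`).

This file only assembles these: **Prop. 5.5 holds as soon as (2.7.2) holds for every level `N ≥ 1`
in all sufficiently large weights** (`prop55_of_span_integralLattice1_of_le`), in particular as
soon as it holds in all weights `k ≥ 2` (`prop55_of_span_integralLattice1_of_two_le`), where it is
Shimura 1971, Thm. 3.52 (the rational structure of `S_k(Γ₁(N))` coming from the Eichler–Shimura
cohomology).  That theorem is the single remaining unproved input of `prop55`; it is not in Mathlib
and not in the tree, so the discharge `prop55_holds` is NOT here.

Since then the tree has proved Shimura's Thm. 3.51 (duality of `S_k(Γ₁(N))` with its Hecke ring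
`𝕋_ℤ = ℤ[T_p, ⟨d⟩]`, `DeligneSerreSpanHeckeDualityProofs`), Thm. 3.52 from Thm. 3.48 (2)
(`span_integralLattice1_of_linearIndependent`, ibid.) and Thm. 3.48 (2) from Shimura's (3.5.20), a
full Hecke-stable lattice in `S_k(Γ₁(N))^∨`, entered as the hypothesis structure
`HeckeStableRealLattice N k` (`DeligneSerreProp27RealLatticeProofs`).  Accordingly the last two
results of this file restate the remaining input of Prop. 5.5 in that final form: **Prop. 5.5 holds
as soon as, for every level `N ≥ 1` and all sufficiently large `n` (threshold depending on `N`),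
`S_{n+2}(Γ₁(N))^∨` carries a full lattice stable under the `T_p^∨` and `⟨d⟩^∨`**
(`prop55_of_heckeStableRealLattice_of_le`, `prop55_of_forall_heckeStableRealLattice`) — the rank
statement of the Eichler–Shimura isomorphism for `Γ₁(N)` (Shimura Thm. 8.4 with Prop. 8.5–8.6),
for which the tree's period lattice `periodLatticeK1` (`EichlerShimuraPeriodsGamma1`: finitely
generated, stable, separating) lacks only the rank count `rank_ℤ = 2 dim_ℂ S_{n+2}(Γ₁(N))`.

The spanning half of that rank statement — `periodLatticeK1 n` spans the dual space over `ℝ`, i.e.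
the real Eichler–Shimura map is injective — is now proved for all levels and all weights
`n + 2 ≥ 7` (`periodLatticeK1_span_real_eq_top`, `EichlerShimuraPeriodsGamma1RealSpanProofs`), so
the remaining input of Prop. 5.5 is the **rank half alone**: for every level `N` and all large `n`,
the period lattice of `S_{n+2}(Γ₁(N))` is the `ℤ`-span of `2 dim_ℂ S_{n+2}(Γ₁(N))` functionals
(`prop55_of_periodLatticeK1_eq_span`; classically: Manin's presentation of the weight-`k` modular
symbols of `Γ₁(N)` and the dimension formula for `S_k(Γ₁(N))`).

## References

* P. Deligne, J.-P. Serre, *Formes modulaires de poids 1*, Ann. Sci. ÉNS (4) 7 (1974), 507–530,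
  Prop. 2.7 and Rem. 2.8 (p. 512), Prop. 5.1, (5.4.1), Prop. 5.5 (pp. 518–520).
* G. Shimura, *Introduction to the arithmetic theory of automorphic functions*, Publ. Math. Soc.
  Japan 11 (1971), Thm. 3.48, (3.5.20), Thm. 3.51, Thm. 3.52 (pp. 83–86); Thm. 8.4, Prop. 8.5,
  Prop. 8.6 (§8.2–8.4).
-/

noncomputable section

namespace Literature.NumberTheory.EllipticCurves.ModularForms.DeligneSerre1974

/-- **Deligne–Serre 1974, Prop. 5.5, granted (2.7.2) in all levels and weights.**  If for every
`N ≥ 1` and every `k` the lattice `L ⊆ S_k(Γ₁(N))` of cusp forms with integral diamond twists spans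
`S_k(Γ₁(N))` over `ℂ` (`DeligneSerre1974_span_integralLattice1`, op. cit. (2.7.2)), then Prop. 5.5
holds: Prop. 5.1 is `prop51_holds`, (2.7.3)–(2.7.4) follow from (2.7.2)
(`prop27_eigenvalues_of_span_integralLattice1`, `prop27_conj_of_span_integralLattice1`), and the
printed deduction of Prop. 5.5 from these is `prop55_of`.
[cite: DeligneSerreASENS1974, Prop. 5.5 with Prop. 2.7 and Prop. 5.1] -/
theorem prop55_of_span_integralLattice1
    (hL : ∀ (N : ℕ) [NeZero N] (k : ℤ), DeligneSerre1974_span_integralLattice1 N k) : prop55 :=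
  prop55_of prop51_holds (prop27_eigenvalues_of_span_integralLattice1 hL)
    (prop27_conj_of_span_integralLattice1 hL)

/-- **Deligne–Serre 1974, Prop. 5.5, granted (2.7.2) in all sufficiently large weights.**  If for
every level `N ≥ 1` there is a threshold `K₀` (depending on `N`) such that the integral lattice
spans `S_k(Γ₁(N))` for all `k ≥ K₀`, then Prop. 5.5 holds: (2.7.2) descends from weights `k + 4`,
`k + 6` to weight `k` (`DeligneSerre1974_span_integralLattice1.of_forall_le`, op. cit. Rem. 2.8 with
`E₄`, `E₆`), and `prop55_of_span_integralLattice1` applies.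
[cite: DeligneSerreASENS1974, Prop. 5.5 with Prop. 2.7 and Rem. 2.8] -/
theorem prop55_of_span_integralLattice1_of_le
    (hL : ∀ (N : ℕ) [NeZero N], ∃ K₀ : ℤ, ∀ k : ℤ, K₀ ≤ k →
      DeligneSerre1974_span_integralLattice1 N k) : prop55 := by
  refine prop55_of_span_integralLattice1 fun N _ k ↦ ?_
  obtain ⟨K₀, hK₀⟩ := hL N
  exact DeligneSerre1974_span_integralLattice1.of_forall_le hK₀ k

/-- **Deligne–Serre 1974, Prop. 5.5, granted (2.7.2) in weights `k ≥ 2`** — the range of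
Shimura 1971, Thm. 3.52 (integral bases of `S_k(Γ₁(N))`, `k ≥ 2`, from the Eichler–Shimura
cohomology), which is thus the one remaining unproved input of Prop. 5.5 in the tree.
[cite: DeligneSerreASENS1974, Prop. 5.5 with Prop. 2.7 and Rem. 2.8] -/
theorem prop55_of_span_integralLattice1_of_two_le
    (hL : ∀ (N : ℕ) [NeZero N] (k : ℤ), 2 ≤ k → DeligneSerre1974_span_integralLattice1 N k) :
    prop55 :=
  prop55_of_span_integralLattice1_of_le fun N _ ↦ ⟨2, hL N⟩

/-- **Deligne–Serre 1974, Prop. 5.5, granted full Hecke-stable lattices in `S_{n+2}(Γ₁(N))^∨` for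
every level and all sufficiently large weights.**  If for every `N ≥ 1` there is a threshold `n₀`
(depending on `N`) such that for all `n ≥ n₀` the dual space `S_{n+2}(Γ₁(N))^∨` has an `ℝ`-basis
whose `ℤ`-span is stable under the transposes `T_p^∨` (all primes `p`) and `⟨d⟩^∨`
(`HeckeStableRealLattice N (n + 2)`: Shimura 1971, (3.5.20), i.e. the Eichler–Shimura lattice of
Thm. 8.4 / Prop. 8.5–8.6 in dual form), then Prop. 5.5 holds: by Shimura's Thm. 3.48 (2) and
Thm. 3.52 such a lattice gives (2.7.2) in weight `n + 2`
(`DeligneSerre1974_span_integralLattice1_of_heckeStableRealLattice`,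
`DeligneSerreProp27RealLatticeProofs`), and `prop55_of_span_integralLattice1_of_le` applies (weight
reduction, Deligne–Serre Rem. 2.8, then (2.7.3)–(2.7.4), Prop. 5.1 and the p. 520 argument).  This
is the precise remaining input of `prop55` in the tree.
[cite: DeligneSerreASENS1974, Prop. 5.5 with Prop. 2.7, Rem. 2.8 and Prop. 5.1] -/
theorem prop55_of_heckeStableRealLattice_of_le
    (H : ∀ (N : ℕ) [NeZero N], ∃ n₀ : ℕ, ∀ n : ℕ, n₀ ≤ n →
      Nonempty (HeckeStableRealLattice N (n + 2))) : prop55 := by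
  refine prop55_of_span_integralLattice1_of_le fun N _ ↦ ?_
  obtain ⟨n₀, hn₀⟩ := H N
  refine ⟨(n₀ : ℤ) + 2, fun k hk ↦ ?_⟩
  obtain ⟨n, rfl⟩ : ∃ n : ℕ, k = (n : ℤ) + 2 := ⟨(k - 2).toNat, by omega⟩
  obtain ⟨Λ⟩ := hn₀ n (by omega)
  exact DeligneSerre1974_span_integralLattice1_of_heckeStableRealLattice (by omega) Λ

/-- **Deligne–Serre 1974, Prop. 5.5, granted full Hecke-stable lattices in `S_{n+2}(Γ₁(N))^∨` for
all levels `N ≥ 1` and all `n ≥ 0`** — the full range of Shimura 1971, (3.5.20) for `Γ' = Γ₁(N)`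
(special case `n₀ = 0` of `prop55_of_heckeStableRealLattice_of_le`; equivalently, through
`DeligneSerre1974_span_integralLattice1_of_forall_heckeStableRealLattice`, (2.7.2) in every weight).
[cite: DeligneSerreASENS1974, Prop. 5.5 with Prop. 2.7, Rem. 2.8 and Prop. 5.1] -/
theorem prop55_of_forall_heckeStableRealLattice
    (H : ∀ (N : ℕ) [NeZero N] (n : ℕ), Nonempty (HeckeStableRealLattice N (n + 2))) : prop55 :=
  prop55_of_heckeStableRealLattice_of_le fun N _ ↦ ⟨0, fun n _ ↦ H N n⟩

/-- **Deligne–Serre 1974, Prop. 5.5, granted the rank half of the Eichler–Shimura isomorphism for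
`Γ₁(N)` in large weights.**  If for every level `N ≥ 1` there is a threshold `n₀` such that for all
`n ≥ n₀` the Eichler–Shimura period lattice of `S_{n+2}(Γ₁(N))` (`periodLatticeK1 n`) is the
`ℤ`-span of `2 dim_ℂ S_{n+2}(Γ₁(N))` functionals (Shimura 1971, Thm. 8.4: `dim_ℝ H¹_P = 2 dim_ℂ S_k`;
Manin's presentation of the weight-`k` modular symbols with the dimension formula), then Prop. 5.5
holds: the spanning half is `periodLatticeK1_span_real_eq_top` (weights `≥ 7`, so one may take
`n ≥ max n₀ 5`), the full lattice is `heckeStableRealLatticeOfGenerators`, and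
`prop55_of_heckeStableRealLattice_of_le` applies.  This is the precise remaining input of `prop55`
in the tree. [cite: DeligneSerreASENS1974, Prop. 5.5 with Prop. 2.7, Rem. 2.8 and Prop. 5.1] -/
theorem prop55_of_periodLatticeK1_eq_span
    (H : ∀ (N : ℕ) [NeZero N], ∃ n₀ : ℕ, ∀ n : ℕ, n₀ ≤ n →
      ∃ g : Fin (2 * Module.finrank ℂ (CuspForm (CongruenceSubgroup.Gamma1 N) (n + 2))) →
          Module.Dual ℂ (CuspForm (CongruenceSubgroup.Gamma1 N) (n + 2)),
        (periodLatticeK1 (N := N) n :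
            Set (Module.Dual ℂ (CuspForm (CongruenceSubgroup.Gamma1 N) (n + 2)))) =
          Submodule.span ℤ (Set.range g)) : prop55 := by
  refine prop55_of_heckeStableRealLattice_of_le fun N _ ↦ ?_
  obtain ⟨n₀, hn₀⟩ := H N
  refine ⟨max n₀ 5, fun n hn ↦ ?_⟩
  obtain ⟨g, hg⟩ := hn₀ n ((le_max_left n₀ 5).trans hn)
  exact ⟨heckeStableRealLatticeOfGenerators ((le_max_right n₀ 5).trans hn) g hg⟩

end Literature.NumberTheory.EllipticCurves.ModularForms.DeligneSerre1974
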